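import Summits.Langlands.Langlands.Theorems.IrreducibilityBySelfDualityPairLBoundaryJS
import Summits.Langlands.Langlands.Theorems.IrreducibilityBySelfDualityPairLBoundaryJSSsv
import Summits.Langlands.Langlands.Theorems.IrreducibilityBySelfDualityPairLBoundaryJSStandardEntire
import Summits.Langlands.Langlands.Theorems.IrreducibilityBySelfDualityPairLBoundaryJSIsOrthoOfLocalTranslate
import Summits.Langlands.Langlands.Theorems.IrreducibilityBySelfDualityPairLBoundaryJSEqConjOfLocalTranslate
import Summits.Langlands.Langlands.Theorems.IrreducibilityBySelfDualityPairLBoundaryJSLocalPairTranslate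
import Summits.Langlands.Langlands.Theorems.IrreducibilityBySelfDualityPairLBoundaryJSOfHumphriesJo
import Literature.NumberTheory.Automorphic.PairLFunctionMeromorphicContinuationRankNeTwistProofs
import Literature.NumberTheory.Automorphic.ArchRankinSelbergTestVector
import Literature.NumberTheory.Automorphic.JPSSGlobalIntegralQuotientUnfolding
import Literature.NumberTheory.Automorphic.JPSSCornerWhittakerUnfolding
import Literature.NumberTheory.Automorphic.WhittakerPeriodExchange
import Literature.NumberTheory.Automorphic.TorusIwasawaTransport
import Literature.NumberTheory.Automorphic.CornerTorusIwasawaData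
import Literature.NumberTheory.Automorphic.WhittakerCoeffHonestCuspForm
import Literature.NumberTheory.Automorphic.WhittakerCoeffTranslateUnramified
import Literature.NumberTheory.Automorphic.WhittakerDecayCuspForm
import Literature.NumberTheory.Automorphic.WhittakerSupportFinite
import Literature.NumberTheory.Automorphic.RankinSelbergUnramifiedTorus
import Literature.NumberTheory.Automorphic.RankinSelbergTorusPairEuler
import Literature.NumberTheory.Automorphic.RankinSelbergTowerFiniteness
import Summits.Langlands.Langlands.Theorems.IrreducibilityBySelfDualityPairLBoundaryJSCornerPairTranslate

/-!
# The `GL_n × GL_m` pair integrand at a good place (`m < n`): translation law and exactness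

Summit `Langlands`, sub-problem `Langlands`, helper file under `Theorems/` supporting the crux
`PairLBoundaryJS` (stmt-Langlands-13622), line `Sketch`, registered stub `stub_gap_euler_limit` (G-EL), part 1
of 3 (part 2: `…PairLBoundaryJSGapPairEuler`, part 3: `…PairLBoundaryJSGapEulerLimit`): the general-corank
version of `…PairLBoundaryJSCornerPairTranslate` (which is the case `n = m + 1`). For the pair integrand
`I_s(a, k) = W(diag(diag(a) k, 1_{n-m})) W'(diag(a) k) |det a|^s δ_{B_m}(a)⁻¹` (`torusPairIntegrandC` of
`W ∘ glCorner`, `W'`, `Φ = 1`), `W` on `GL_n(𝔸_K)`, `W'` on `GL_m(𝔸_K)`: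

* `glCorner_glDiagonal`, `glCorner_torusPoint` — `diag(diag(d), 1_{n-m}) = diag((d, 1))` (padding by
  `cornerExtend`) and `diag(diag(a) k, 1) = diag((a, 1)) diag(k, 1)`;
* `gapPairIntegrand_localTorusPow_mul` — **the translation law** at `v`: for `W` (rank `n`) and `W'`
  (rank `m`) unramified Whittaker–Hecke data at `v` with parameters `x`, `y`,
  `I_s(ϖ_v^μ a, k) = s_{(μ,0)}(x) s_μ(y) q_v^{-(s+(n-m)/2)|μ|} I_s(a, k)` on the unit box at `v` (the PADDED Schur
  coefficient, `glCorner(ϖ^μ) = ϖ^{(μ,0)}`, Shintani's formula in ranks `n` and `m`, and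
  `b_n((μ,0)) = b_m(μ) + (n - m)|μ|`, `torusExponent_cornerExtend`; Cogdell (2004), proof of Thm. 3.3;
  Getz–Hahn (2024), proof of Thm. 11.6.1);
* `apply_glCorner_torusPoint_eq_zero_of_not_mem_iUnion` — **exactness** (`m < n`): for `‖W‖`
  central-invariant, `W(diag(diag(a) k, 1)) = 0` on `B(G)` off the translates `ϖ_v^μ B(insert v G)`, `μ ∈ ℕ^m`
  (shift the `v`-exponents `(e, 0)` of `diag((a, 1))` by the central `ϖ_v^M 1_n`; `(e + M, M, …, M)` is antitone
  only if `e ∈ ℕ^m` — the padded zeros play the rôle of the test function `Φ` of the `n × n` case).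

## References

* J. W. Cogdell, *Analytic theory of L-functions for GL_n*, in *An Introduction to the Langlands
  Program* (2004), §2.3 Thm. 2.2, §3 Thm. 3.3 [CogdellAnalyticTheory2004].
* J. R. Getz, H. Hahn, *An Introduction to Automorphic Representations*, GTM 300 (2024), Thm. 11.6.1
  [GetzHahn2024].
-/

noncomputable section

-- `Summit.Langlands.Langlands.…` (summit = sub-problem name, D-0017 layout) trips `dupNamespace`
set_option linter.dupNamespace false

open scoped MatrixGroups Topology Pointwise ENNReal NNReal ComplexConjugate InnerProductSpace ContDiff
-- the place subtypes indexing `mixedSpace K` are `Fintype` classically (`NormedCommRing (mixedSpace K)`)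
open scoped Classical Matrix.Norms.Operator
open NumberField IsDedekindDomain MeasureTheory Measure Matrix Set Filter WithZero
open NumberField.mixedEmbedding
open Literature.NumberTheory.Automorphic AdelicGroupData
open Literature.NumberTheory.GaloisRepresentations (ideleGroup HeckeCharacter)
open Literature.MeasureTheory.Group
open Literature.RingTheory.SymmetricFunctions.SymmPoly
open ValuativeRel

-- the automorphic quotient carries the tree's Borel σ-algebra, not Mathlib's quotient σ-algebra
attribute [-instance] Quotient.instMeasurableSpace QuotientGroup.measurableSpace

-- the house local instances, exactly as in `RankinSelbergUnfoldingIdentity`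
attribute [local instance] adelicBorel borelSpace_adelic locallyCompactSpace_adelic secondCountableTopology_gl_adelic
  glAdeleBorel borelSpace_glAdele borelSpace_ideleGroup secondCountableTopology_ideleGroup

-- Mathlib idiom: the commutator Lie ring on matrices, to mention `(archGroupGL n K).lie`
attribute [local instance 100] LieRing.ofAssociativeRing

namespace Summit.Langlands.Langlands.Theorems.GapPairTranslate

open CornerPairTranslate

/-! ### The corner of a diagonal matrix and of a torus point, at general corank -/

section Algebra

variable {m n : ℕ} {K : Type} [Field K] [NumberField K]

/-- **`diag(diag(d), 1_{n-m}) = diag((d, 1, …, 1))`**: the corner embedding of a diagonal matrix is the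
diagonal matrix with entries padded by `1` (`cornerExtend h d 1`). [folklore] -/
theorem glCorner_glDiagonal {R : Type*} [CommRing R] (h : m ≤ n) (d : Fin m → Rˣ) :
    glCorner R h (glDiagonal m R d) = glDiagonal n R (cornerExtend h d 1) := by
  refine Units.ext ?_
  rw [coe_glCorner, coe_glDiagonal, coe_glDiagonal, ← Matrix.diagonal_one, Matrix.fromBlocks_diagonal,
    Matrix.reindex_apply, Matrix.submatrix_diagonal_equiv]
  congr 1
  funext i
  obtain ⟨z, rfl⟩ := (finBlockEquiv h).surjective i
  rcases z with a | b <;> simp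

/-- **The corner of a torus point**: `diag(diag(a) k, 1_{n-m}) = diag((a, 1)) · diag(k, 1_{n-m})`.
[folklore] -/
theorem glCorner_torusPoint (h : m ≤ n) (a : Fin m → ideleGroup K) (k : ↥(maximalCompactAdelic m K)) :
    glCorner (AdeleRing (𝓞 K) K) h (torusPoint m K (a, k)) =
      glDiagonal n (AdeleRing (𝓞 K) K) (cornerExtend h a 1) *
        glCorner (AdeleRing (𝓞 K) K) h
          (show GL (Fin m) (AdeleRing (𝓞 K) K) from (k : (AdelicGroupData.gl m K).Adelic)) := by
  rw [torusPoint, map_mul, glCorner_glDiagonal]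

end Algebra

/-! ### The pair integrand, the padded local coefficient and the translation law -/

section Translation

variable {m n : ℕ} {K : Type} [Field K] [NumberField K] {v : HeightOneSpectrum (𝓞 K)}
  {ϖ : (v.adicCompletion K)ˣ} {x : Fin n → ℂ} {y : Fin m → ℂ}
  {W : GL (Fin n) (AdeleRing (𝓞 K) K) → ℂ} {W' : GL (Fin m) (AdeleRing (𝓞 K) K) → ℂ}

/-- Unfolding the pair integrand of `W ∘ glCorner`, `W'`, `Φ = 1` at `(a, k)`. [folklore] -/
theorem gapPairIntegrand_apply (h : m ≤ n) (s : ℂ) (a : Fin m → ideleGroup K) (k : ↥(maximalCompactAdelic m K)) :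
    torusPairIntegrandC m K (fun g => W (glCorner (AdeleRing (𝓞 K) K) h g)) W' (fun _ => (1 : ℝ)) s (a, k) =
      W (glCorner (AdeleRing (𝓞 K) K) h (torusPoint m K (a, k))) * W' (torusPoint m K (a, k)) *
        torusWeightC m K s a := by
  simp only [torusPairIntegrandC, Complex.ofReal_one, mul_one]

/-- **The powers of `q_v` in the translation law combine to `q_v^{-(s+(n-m)/2)|μ|}`**:
`(√q)^{-b_n((μ,0))} (√q)^{-b_m(μ)} q^{b_m(μ) - s|μ|} = (q^{-(s+(n-m)/2)})^{|μ|}`, by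
`b_n((μ,0)) = b_m(μ) + (n - m)|μ|` (`torusExponent_cornerExtend`). [folklore] -/
theorem sqrt_zpow_mul_sqrt_zpow_mul_cpow (h : m ≤ n) (s : ℂ) (mu : Fin m → ℕ) :
    (((Real.sqrt (v.residueCard : ℝ) : ℝ) : ℂ)) ^ (-torusExponent (cornerExtend h mu 0)) *
      (((Real.sqrt (v.residueCard : ℝ) : ℝ) : ℂ)) ^ (-torusExponent mu) *
        (v.residueCard : ℂ) ^ ((torusExponent mu : ℂ) - s * ∑ i, (mu i : ℂ)) =
      ((v.residueCard : ℂ) ^ (-(s + ((n : ℂ) - (m : ℂ)) / 2))) ^ (∑ i, mu i) := by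
  have hq : (0 : ℝ) < v.residueCard := by exact_mod_cast zero_lt_one.trans v.one_lt_residueCard
  have hq0 : (v.residueCard : ℂ) ≠ 0 := by exact_mod_cast hq.ne'
  have hr : (((Real.sqrt (v.residueCard : ℝ) : ℝ) : ℂ)) = (v.residueCard : ℂ) ^ ((2 : ℂ)⁻¹) := by
    rw [Real.sqrt_eq_rpow, Complex.ofReal_cpow hq.le, Complex.ofReal_natCast]
    congr 1
    push_cast
    ring
  rw [hr, ← Complex.cpow_int_mul, ← Complex.cpow_int_mul, ← Complex.cpow_add _ _ hq0, ← Complex.cpow_add _ _ hq0,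
    ← Complex.cpow_nat_mul, torusExponent_cornerExtend]
  congr 1
  push_cast
  ring

/-- **The pair integrand on the translate `ϖ_v^μ · a` of a point `a` of the unit box** (the translation
law at general corank). If `W` (rank `n`) and `W'` (rank `m ≤ n`) are unramified Whittaker–Hecke data at `v`
with parameters `x`, `y`, then for `a` with unit entries at `v`, `k ∈ K` and `μ ∈ ℕ^m`,
`I_s(ϖ^μ a, k) = s_{(μ,0)}(x) s_μ(y) q_v^{-(s+(n-m)/2)|μ|} · I_s(a, k)`:
`diag(ι_v(ϖ^μ) g, 1) = ι_v(ϖ^{(μ,0)}) diag(g, 1)`, Shintani's formula for `W` at `ϖ^{(μ,0)}` contributes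
`q_v^{-b_n((μ,0))/2} s_{(μ,0)}(x)`, for `W'` at `ϖ^μ` it contributes `q_v^{-b_m(μ)/2} s_μ(y)`, and the complex
Jacobian `|det|^s δ_{B_m}⁻¹` contributes `q_v^{b_m(μ) - s|μ|}` (Cogdell (2004), proof of Thm. 3.3; Getz–Hahn
(2024), proof of Thm. 11.6.1). [folklore] -/
theorem gapPairIntegrand_localTorusPow_mul (h : m ≤ n) (hW : IsTorusUnramifiedAt n K W v ϖ x)
    (hW' : IsTorusUnramifiedAt m K W' v ϖ y) (s : ℂ) (mu : Fin m → ℕ)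
    {a : Fin m → ideleGroup K} (ha : ∀ i, Valued.v (((a i : ideleGroup K) : AdeleRing (𝓞 K) K).2 v) = 1)
    (k : ↥(maximalCompactAdelic m K)) :
    torusPairIntegrandC m K (fun g => W (glCorner (AdeleRing (𝓞 K) K) h g)) W' (fun _ => (1 : ℝ)) s
        (localTorusPow ϖ mu * a, k) =
      schurTrunc x (cornerExtend h mu 0) * schurTrunc y mu *
          ((v.residueCard : ℂ) ^ (-(s + ((n : ℂ) - (m : ℂ)) / 2))) ^ (∑ i, mu i) *
        torusPairIntegrandC m K (fun g => W (glCorner (AdeleRing (𝓞 K) K) h g)) W' (fun _ => (1 : ℝ)) s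
          (a, k) := by
  set g := torusPoint m K (a, k) with hg
  have hpt : torusPoint m K (localTorusPow ϖ mu * a, k) = GLn.ofLocal m K v (piPowGL ϖ.ne_zero mu) * g := by
    rw [torusPoint_mul, glDiagonal_localTorusPow]
  -- `diag(ι_v(ϖ^μ) g, 1) = ι_v(ϖ^{(μ,0)}) diag(g, 1)`
  have hcpt : glCorner (AdeleRing (𝓞 K) K) h (torusPoint m K (localTorusPow ϖ mu * a, k)) =
      GLn.ofLocal n K v (piPowGL ϖ.ne_zero (cornerExtend h mu 0)) * glCorner (AdeleRing (𝓞 K) K) h g := by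
    rw [hpt, map_mul, glCorner_ofLocal, glCorner_piPowGL]
  have hgc : localComponent v (glCorner (AdeleRing (𝓞 K) K) h g) ∈ glInt n (v.adicCompletion K) := by
    rw [localComponent_glCorner]
    exact glCorner_mem_glInt h (localComponent_torusPoint_mem_glInt ha k)
  -- Shintani for `W` at `ϖ^{(μ,0)}` and for `W'` at `ϖ^μ`
  have hWμ : W (glCorner (AdeleRing (𝓞 K) K) h (torusPoint m K (localTorusPow ϖ mu * a, k))) =
      (((Real.sqrt (v.residueCard : ℝ) : ℝ) : ℂ)) ^ (-torusExponent (cornerExtend h mu 0)) *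
        schurTrunc x (cornerExtend h mu 0) * W (glCorner (AdeleRing (𝓞 K) K) h g) := by
    rw [hcpt]
    exact hW.apply_ofLocal_piPowGL_mul hgc _
  have hW'μ : W' (torusPoint m K (localTorusPow ϖ mu * a, k)) =
      (((Real.sqrt (v.residueCard : ℝ) : ℝ) : ℂ)) ^ (-torusExponent mu) * schurTrunc y mu * W' g := by
    rw [hpt]
    exact hW'.apply_ofLocal_piPowGL_mul (localComponent_torusPoint_mem_glInt ha k) mu
  -- the complex Jacobian
  have hwt : torusWeightC m K s (localTorusPow ϖ mu * a) =
      (v.residueCard : ℂ) ^ ((torusExponent mu : ℂ) - s * ∑ i, (mu i : ℂ)) * torusWeightC m K s a := by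
    rw [torusWeightC_mul, torusWeightC_localTorusPow hW'.valued_eq]
  rw [gapPairIntegrand_apply, gapPairIntegrand_apply, hWμ, hW'μ, hwt, ← sqrt_zpow_mul_sqrt_zpow_mul_cpow h s mu]
  ring

end Translation

/-! ### Exactness: the corner Whittaker function vanishes off the translates of the unit box -/

section Support

variable {m n : ℕ} {K : Type} [Field K] [NumberField K] {v : HeightOneSpectrum (𝓞 K)}
  {ϖ : (v.adicCompletion K)ˣ} {x : Fin n → ℂ} {W : GL (Fin n) (AdeleRing (𝓞 K) K) → ℂ}

/-- **`W(diag(diag(a) k, 1_{n-m}))` vanishes on the unit box off the translates `ϖ_v^μ B`, `μ ∈ ℕ^m`**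
(`m < n`). For `W` an unramified Whittaker–Hecke datum of rank `n` at `v ∉ G` with `‖W‖` invariant under the
centre, `a ∈ B(G)` and `k ∈ K`: if `a ∉ ⋃_μ ϖ_v^μ B(insert v G)` then `W(diag(diag(a) k, 1)) = 0`. Writing the
`v`-exponents of `a` as `e ∈ ℤ^m`, those of `diag((a, 1))` are `(e, 0)`; shifting by the central `ϖ_v^M 1_n`,
`M ≫ 0`, Shintani's formula in rank `n` shows `W = 0` at the point unless `(e + M, M, …, M)` is antitone, i.e.
unless `e` is antitone AND `e_{m-1} ≥ 0` (here `m < n` is used) — the padded exponents play the rôle of the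
test function `Φ(e_n ·)` of the `n × n` case; but then `e ∈ ℕ^m` and `a ∈ ϖ_v^e B(insert v G)` (Cogdell (2004),
proof of Thm. 3.3: "`W(ϖ^J) = 0` unless `J` is dominant"). [folklore] -/
theorem apply_glCorner_torusPoint_eq_zero_of_not_mem_iUnion (hmn : m < n) (hW : IsTorusUnramifiedAt n K W v ϖ x)
    (hWZ : ∀ (z : ideleGroup K) (g : GL (Fin n) (AdeleRing (𝓞 K) K)),
      ‖W (Matrix.GeneralLinearGroup.scalar (Fin n) z * g)‖ = ‖W g‖)
    {G : Set (HeightOneSpectrum (𝓞 K))} (hv : v ∉ G) {a : Fin m → ideleGroup K}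
    (ha : a ∈ unitBox (n := m) (K := K) G) (k : ↥(maximalCompactAdelic m K))
    (hnot : a ∉ ⋃ mu : Fin m → ℕ, localTorusPow ϖ mu • unitBox (n := m) (K := K) (insert v G)) :
    W (glCorner (AdeleRing (𝓞 K) K) hmn.le (torusPoint m K (a, k))) = 0 := by
  -- the `v`-adic exponents of the entries of `a`
  set e : Fin m → ℤ := fun i => -WithZero.log (Valued.v (((a i : ideleGroup K) : AdeleRing (𝓞 K) K).2 v))
    with he
  have hev : ∀ i, Valued.v (((a i : ideleGroup K) : AdeleRing (𝓞 K) K).2 v) = WithZero.exp (-(e i)) := by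
    intro i
    simp only [he, neg_neg]
    rw [WithZero.exp_log (valued_snd_idele_ne_zero (a i))]
  by_contra hW0
  -- Step 1: a non-negative shift of the exponents
  obtain ⟨M, hM⟩ : ∃ M : ℕ, ∀ i, 0 ≤ e i + M := by
    refine ⟨∑ i, (e i).natAbs, fun i => ?_⟩
    have h1 : (e i).natAbs ≤ ∑ j, (e j).natAbs :=
      Finset.single_le_sum (f := fun j => (e j).natAbs) (fun j _ => Nat.zero_le _) (Finset.mem_univ i)
    omega
  -- the padded shifted exponent vector `ν = (e + M, M, …, M) ∈ ℕ^n`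
  set nu : Fin n → ℕ := cornerExtend hmn.le (fun i => (e i + M).toNat) M with hnu
  -- the central idele `ζ = ϖ^M` at `v`, and the rank-`n` torus element `a' = ζ · (a, 1)`
  set ζ : ideleGroup K := Literature.NumberTheory.GaloisRepresentations.localUnits v (ϖ ^ M) with hζ
  set a' : Fin n → ideleGroup K := (fun _ => ζ) * cornerExtend hmn.le a 1 with ha'
  have hζv : Valued.v ((ζ : AdeleRing (𝓞 K) K).2 v) = WithZero.exp (-(M : ℤ)) := by
    rw [hζ, Literature.NumberTheory.GaloisRepresentations.localUnits_snd_apply_self, Units.val_pow_eq_pow_val,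
      map_pow, hW.valued_eq, ← WithZero.exp_nsmul]
    simp
  have hζw : ∀ w, w ≠ v → (ζ : AdeleRing (𝓞 K) K).2 w = 1 := fun w hw =>
    localTorusPow_snd_apply_of_ne ϖ (fun _ : Fin 1 => M) 0 hw
  -- the `w`-components of the entries of `a'`
  have ha'w : ∀ (w : HeightOneSpectrum (𝓞 K)) (i : Fin n),
      Valued.v (((a' i : ideleGroup K) : AdeleRing (𝓞 K) K).2 w) =
        Valued.v ((ζ : AdeleRing (𝓞 K) K).2 w) *
          Valued.v ((((cornerExtend hmn.le a 1 : Fin n → ideleGroup K) i : ideleGroup K) :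
            AdeleRing (𝓞 K) K).2 w) := by
    intro w i
    rw [ha', Pi.mul_apply, Units.val_mul, ← AdelicGroupData.adeleEval_apply, map_mul, Valuation.map_mul,
      AdelicGroupData.adeleEval_apply, AdelicGroupData.adeleEval_apply]
  have hone : ∀ w : HeightOneSpectrum (𝓞 K), Valued.v (((1 : ideleGroup K) : AdeleRing (𝓞 K) K).2 w) = 1 := by
    intro w
    rw [← AdelicGroupData.adeleEval_apply, Units.val_one, map_one, map_one]
  have ha'v : ∀ i, Valued.v (((a' i : ideleGroup K) : AdeleRing (𝓞 K) K).2 v) = WithZero.exp (-(nu i : ℤ)) := by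
    intro i
    rw [ha'w, hζv]
    obtain ⟨z, rfl⟩ := (finBlockEquiv hmn.le).surjective i
    rcases z with j | b
    · have hj : ((nu (finBlockEquiv hmn.le (Sum.inl j)) : ℕ) : ℤ) = e j + M := by
        simp only [hnu, cornerExtend_inl]
        exact Int.toNat_of_nonneg (hM j)
      rw [cornerExtend_inl, hev j, hj, ← WithZero.exp_add]
      congr 1
      ring
    · rw [cornerExtend_inr, hone, mul_one]
      simp only [hnu, cornerExtend_inr]
  have ha'G : a' ∈ unitBox (n := n) (K := K) G := by
    intro w hw i
    have hwv : w ≠ v := fun h => hv (h ▸ hw)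
    change Valued.v (((a' i : ideleGroup K) : AdeleRing (𝓞 K) K).2 w) = 1
    rw [ha'w, hζw w hwv, map_one, one_mul]
    obtain ⟨z, rfl⟩ := (finBlockEquiv hmn.le).surjective i
    rcases z with j | b
    · rw [cornerExtend_inl]
      exact ha w hw j
    · rw [cornerExtend_inr]
      exact hone w
  -- `a' = ϖ^ν a₀` with `a₀` a unit at `v`
  obtain ⟨a₀, ha₀, ha₀eq⟩ := Set.mem_smul_set.1 (mem_smul_unitBox_of_valued_eq hW.valued_eq hv ha'G ha'v)
  have ha₀v : ∀ i, Valued.v (((a₀ i : ideleGroup K) : AdeleRing (𝓞 K) K).2 v) = 1 := fun i =>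
    ha₀ v (Set.mem_insert v G) i
  -- the torus points: `(ζ 1_n) diag(diag(a) k, 1) = diag(a') diag(k, 1) = ι_v(ϖ^ν) (diag(a₀) diag(k, 1))`
  have htp1 : Matrix.GeneralLinearGroup.scalar (Fin n) ζ *
      glCorner (AdeleRing (𝓞 K) K) hmn.le (torusPoint m K (a, k)) =
        glDiagonal n (AdeleRing (𝓞 K) K) a' *
          glCorner (AdeleRing (𝓞 K) K) hmn.le
            (show GL (Fin m) (AdeleRing (𝓞 K) K) from (k : (AdelicGroupData.gl m K).Adelic)) := by
    rw [glCorner_torusPoint, ← mul_assoc, ha', map_mul (glDiagonal n (AdeleRing (𝓞 K) K)), glDiagonal_const]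
  have htp2 : glDiagonal n (AdeleRing (𝓞 K) K) a' *
      glCorner (AdeleRing (𝓞 K) K) hmn.le
        (show GL (Fin m) (AdeleRing (𝓞 K) K) from (k : (AdelicGroupData.gl m K).Adelic)) =
      GLn.ofLocal n K v (piPowGL ϖ.ne_zero nu) *
        (glDiagonal n (AdeleRing (𝓞 K) K) a₀ *
          glCorner (AdeleRing (𝓞 K) K) hmn.le
            (show GL (Fin m) (AdeleRing (𝓞 K) K) from (k : (AdelicGroupData.gl m K).Adelic))) := by
    rw [← ha₀eq, smul_eq_mul, map_mul, glDiagonal_localTorusPow, mul_assoc]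
  have hg₀ : localComponent v (glDiagonal n (AdeleRing (𝓞 K) K) a₀ *
      glCorner (AdeleRing (𝓞 K) K) hmn.le
        (show GL (Fin m) (AdeleRing (𝓞 K) K) from (k : (AdelicGroupData.gl m K).Adelic))) ∈
      glInt n (v.adicCompletion K) := by
    rw [show localComponent v (glDiagonal n (AdeleRing (𝓞 K) K) a₀ *
        glCorner (AdeleRing (𝓞 K) K) hmn.le
          (show GL (Fin m) (AdeleRing (𝓞 K) K) from (k : (AdelicGroupData.gl m K).Adelic))) =
        localComponent v (glDiagonal n (AdeleRing (𝓞 K) K) a₀) *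
          localComponent v (glCorner (AdeleRing (𝓞 K) K) hmn.le
            (show GL (Fin m) (AdeleRing (𝓞 K) K) from (k : (AdelicGroupData.gl m K).Adelic))) from map_mul _ _ _,
      localComponent_glCorner]
    exact Subgroup.mul_mem _ (localComponent_glDiagonal_mem_glInt ha₀v)
      (glCorner_mem_glInt hmn.le (localComponent_mem_glInt_of_mem_maximalCompactAdelic k.2))
  -- Shintani at `a₀`
  have hShin := hW.apply_ofLocal_piPowGL_mul hg₀ nu
  have hnormW : ‖W (glCorner (AdeleRing (𝓞 K) K) hmn.le (torusPoint m K (a, k)))‖ =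
      ‖(((Real.sqrt (v.residueCard : ℝ) : ℝ) : ℂ)) ^ (-torusExponent nu) * schurTrunc x nu *
        W (glDiagonal n (AdeleRing (𝓞 K) K) a₀ *
          glCorner (AdeleRing (𝓞 K) K) hmn.le
            (show GL (Fin m) (AdeleRing (𝓞 K) K) from (k : (AdelicGroupData.gl m K).Adelic)))‖ := by
    rw [← hWZ ζ, htp1, htp2, hShin]
  -- Step 2: `ν` is antitone
  have hanti : Antitone nu := by
    by_contra hna
    apply hW0
    rw [← norm_eq_zero, hnormW, schurTrunc_of_not_antitone x hna, mul_zero, zero_mul, norm_zero]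
  -- Step 3: all the exponents `e_i` are `≥ 0` (`ν_i = e_i + M ≥ ν_m = M`, as `m < n`)
  have heall : ∀ i, 0 ≤ e i := by
    intro i
    have h := hanti (finBlockEquiv_inl_lt_inr hmn.le i ⟨0, Nat.sub_pos_of_lt hmn⟩).le
    simp only [hnu, cornerExtend_inl, cornerExtend_inr] at h
    have h' : ((M : ℕ) : ℤ) ≤ (((e i + M).toNat : ℕ) : ℤ) := by exact_mod_cast h
    rw [Int.toNat_of_nonneg (hM i)] at h'
    omega
  -- Step 4: `a ∈ ϖ^e B(insert v G)`
  exact hnot (Set.mem_iUnion.2 ⟨fun i => (e i).toNat,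
    mem_smul_unitBox_of_valued_eq hW.valued_eq hv ha fun i => by rw [hev i, Int.toNat_of_nonneg (heall i)]⟩)

end Support

/-! ### The registered sub-goal -/

/-- **SUB-GOAL (G-EL, part 1/3) — exactness of the `GL_n × GL_m` Euler factorisation**, the `∀`-form of
`apply_glCorner_torusPoint_eq_zero_of_not_mem_iUnion` (registered on stmt-Langlands-13622 so that this helper
file lands `--supports`; the translation law `gapPairIntegrand_localTorusPow_mul` is the other export, both
consumed by part 2, `…PairLBoundaryJSGapPairEuler.stub_gap_euler`). [folklore] -/
theorem stub_gap_translate :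
    ∀ {n m : ℕ} {K : Type} [Field K] [NumberField K] (hmn : m < n) {v : HeightOneSpectrum (𝓞 K)}
      {ϖ : (v.adicCompletion K)ˣ} {x : Fin n → ℂ} {W : GL (Fin n) (AdeleRing (𝓞 K) K) → ℂ},
      IsTorusUnramifiedAt n K W v ϖ x →
      (∀ (z : ideleGroup K) (g : GL (Fin n) (AdeleRing (𝓞 K) K)),
        ‖W (Matrix.GeneralLinearGroup.scalar (Fin n) z * g)‖ = ‖W g‖) →
      ∀ {G : Set (HeightOneSpectrum (𝓞 K))}, v ∉ G → ∀ {a : Fin m → ideleGroup K}, a ∈ unitBox (n := m) (K := K) G →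
      ∀ k : ↥(maximalCompactAdelic m K),
      a ∉ (⋃ mu : Fin m → ℕ, localTorusPow ϖ mu • unitBox (n := m) (K := K) (insert v G)) →
      W (glCorner (AdeleRing (𝓞 K) K) hmn.le (torusPoint m K (a, k))) = 0 := by
  intro n m K _ _ hmn v ϖ x W hW hWZ G hv a ha k hnot
  exact apply_glCorner_torusPoint_eq_zero_of_not_mem_iUnion hmn hW hWZ hv ha k hnot

end Summit.Langlands.Langlands.Theorems.GapPairTranslate

end
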